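import Summits.Ventures.DiscreteObjects.Hadamard.Order167InvertingIndexFour668

/-!
# H(668): |N(⟨σ₁₆₇⟩) : ±⟨σ₁₆₇⟩| = 8 (index-4 centraliser AND an inverting automorphism) EXISTS iff a classical
# WILLIAMSON MATRIX of order 668 — `W(A,B,C,D)` with SYMMETRIC circulant blocks of order 167 — exists (kernel iff)

Framing: lottery ticket; floor = certified bounds/negative ranges.

Cell pub-namedobj (venture DiscreteObjects), target (H), hadamard gen 22.  Gen 21 (`Order167WilliamsonIff668`) proved: an
H(668) with a signed automorphism `σ` of order `167` whose centraliser has index `4` over `±⟨σ⟩` exists iff a WILLIAMSON-TYPE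
Hadamard matrix `W(A,B,C,D) = (A B C D / −B A −D C / −C D A −B / −D −C B A)` with CIRCULANT `167`-blocks exists.  Gen 20/21
(`Order167InvertingNormalizer668`, `Order167NormalizerSmall668`): the normaliser adds at most a factor `2` (`N/C ≤ C₂`, the
extra coset INVERTS `σ`), and a block-preserving inverting automorphism makes all sixteen blocks symmetric.  Here the two are
combined, using the group step of `Order167InvertingIndexFour668` (some `V₄`-translate of any inverting `ρ` preserves all
blocks, has `4 + 4` fixed points and commutes with the quaternion labels):
* **`exists_symmWilliamsonArray_of_inverting_fixed`**: index `4` + an inverting `ρ` commuting (pairs, column side) with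
  `τ₁, τ₂` and fixing a row `x₀` and a column `y₀` ⇒ basing the gen-21 construction at `(x₀, y₀)` the four Williamson blocks
  `A'_k(r) = E_k(y₀) H'(x₀, κ^r Q_k y₀)` are SYMMETRIC: `A'_k(−r) = A'_k(r)` [`ρ` acts on `H'` with signs constant along
  `σ`-orbits; `H'(x₀, κ^{−r} Q_k y₀) = H'(ρ x₀, ρ(κ^r Q_k y₀)) = η_k H'(x₀, κ^r Q_k y₀)` and `r = 0` gives `η_k = 1`].
* **`exists_symmWilliamsonArray_of_index_four_inverting`**: index `4` + ANY automorphism inverting `σ` ⇒ `H` is equivalent to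
  a classical Williamson matrix with symmetric circulant blocks of order `167`.
* `symmWilliamsonArray_inverting_aut` (converse): for symmetric blocks the block reversal `(g, s) ↦ (g, −s)` is a permutation
  automorphism of the Williamson array inverting the block shift, with the fixed row/column `((0,0),0)`.
* **`hadamard668_normalizer_index_eight_iff_williamson`**: **(∃ H(668) with a signed automorphism σ of order 167, two
  centralising automorphisms with distinct non-trivial involution pairs, and an automorphism inverting σ) ⇔ (∃ a Williamson
  matrix of order 668: `W(A,B,C,D)` Hadamard with `A, B, C, D` symmetric circulant of order 167)**; `..._iff_williamson'`: the
  same with 'a normalising automorphism that does not centralise' (any multiplier).  `symmWilliamsonArray_control_order12`: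
  the right-hand side is inhabited at `w = 3` (Williamson's `H(12)`, `A = J`, `B = C = D = 2I − J`; `decide`).
DICTIONARY.  Both sides are OPEN: Williamson matrices `W(A,B,C,D)` with symmetric circulant blocks are enumerated in print only
for odd block orders `≤ 59` (Holzmann–Kharaghani–Tayfeh-Rezaie 2008; none exist for 35, 47, 53, 59) and even orders `≤ 70`; block
order `167` is far beyond every exhaustive range and no Williamson matrix of order `668` is known (H(668) is the smallest unknown
order, Kharaghani–Mohammadian–Tayfeh-Rezaie 2026 §1).  So: *a classical Williamson matrix of order 668 exists iff some H(668)
has the full local symmetry `(Q₈ ⋊ C₂)`-over-`C₁₆₇` at the prime 167.*  H(668) untouched; no order excluded; HITS 0/4.  Ours; no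
`sorry`, no definitions (arrays are `Matrix.of` terms), default heartbeats.
-/

namespace Summit.Ventures.DiscreteObjects.Hadamard

open Finset BigOperators Matrix

open Literature.Combinatorics.Designs.GoethalsSeidel (IsHadamardMatrix)

variable {ι : Type*} [Fintype ι] [DecidableEq ι]

section main
variable {H : Matrix ι ι ℤ} (hH : IsHadamardMatrix H) (hι : Fintype.card ι = 668)
  {π κ : Equiv.Perm ι} {d e : ι → ℤ} (haut : IsSignedAut H π κ d e)
  (hπ : π ^ 167 = 1) (hκ : κ ^ 167 = 1) (hne : π ≠ 1 ∨ κ ≠ 1)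
  {π₁ κ₁ π₂ κ₂ : Equiv.Perm ι} {d₁ e₁ d₂ e₂ : ι → ℤ}
  (h₁ : IsSignedAut H π₁ κ₁ d₁ e₁) (h₂ : IsSignedAut H π₂ κ₂ d₂ e₂) (hc₁ : Commute π₁ π) (hc₁' : Commute κ₁ κ)
  (hc₂ : Commute π₂ π) (hc₂' : Commute κ₂ κ) (hi₁ : π₁ ^ 2 = 1) (hi₁' : κ₁ ^ 2 = 1) (hi₂ : π₂ ^ 2 = 1)
  (hi₂' : κ₂ ^ 2 = 1) (hne₁ : π₁ ≠ 1 ∨ κ₁ ≠ 1) (hne₂ : π₂ ≠ 1 ∨ κ₂ ≠ 1) (hne₁₂ : π₁ ≠ π₂ ∨ κ₁ ≠ κ₂)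
  {π' κ' : Equiv.Perm ι} {d' e' : ι → ℤ} (haut' : IsSignedAut H π' κ' d' e')
  {μ : ℕ} (hnπ : π' * π = π ^ μ * π') (hnκ : κ' * κ = κ ^ μ * κ') (hμ : μ % 167 = 166)
include hH hι haut hπ hκ hne h₁ h₂ hc₁ hc₁' hc₂ hc₂' hi₁ hi₁' hi₂ hi₂' hne₁ hne₂ hne₁₂ haut' hnπ hnκ hμ

/-- **Index 4 + an inverting automorphism with a fixed row and a fixed column, commuting with the labels on the column side
⇒ a Williamson array with SYMMETRIC circulant blocks.**  (The gen-21 construction of `Order167WilliamsonIff668` based at the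
fixed row `x₀` and the fixed column `y₀`.) -/
theorem exists_symmWilliamsonArray_of_inverting_fixed (hcm₁' : Commute κ' κ₁) (hcm₂' : Commute κ' κ₂) {x₀ y₀ : ι}
    (hx₀ : π' x₀ = x₀) (hy₀ : κ' y₀ = y₀) :
    ∃ A' : ZMod 2 × ZMod 2 → ZMod 167 → ℤ, (∀ k r, A' k (-r) = A' k r) ∧
      IsHadamardMatrix (Matrix.of fun (a b : (ZMod 2 × ZMod 2) × ZMod 167) =>
        (if a.1 = 0 then (1 : ℤ) else if a.1 = (1, 0) then (if b.1.1 = 1 then 1 else -1)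
          else if a.1 = (0, 1) then (if b.1.1 = b.1.2 then -1 else 1) else (if b.1.2 = 1 then 1 else -1)) *
        A' (a.1 + b.1) (b.2 - a.2)) := by
  have p167 : Nat.Prime 167 := by norm_num
  have hcard : (Fintype.card ι : ℤ) ≠ 0 := by rw [hι]; norm_num
  obtain ⟨⟨hcomm, hcomm'⟩, -, -⟩ :=
    centralizer167_involutions_commute hH hι haut hπ hκ hne h₁ h₂ hc₁ hc₁' hc₂ hc₂' hi₁ hi₁' hi₂ hi₂'
  -- the sign relations of gen 21 (column side)
  obtain ⟨-, -, hN1⟩ := centralizer167_involution_nega hH hι haut hπ hκ hne h₁ hc₁ hi₁ hi₁' hne₁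
  obtain ⟨-, -, hN2⟩ := centralizer167_involution_nega hH hι haut hπ hκ hne h₂ hc₂ hi₂ hi₂' hne₂
  obtain ⟨-, hAC⟩ := centralizer167_involutions_anticommute hH hι haut hπ hκ hne h₁ h₂ hc₁ hc₁' hc₂ hc₂' hi₁ hi₁' hi₂
    hi₂' hne₁ hne₂ hne₁₂
  -- re-sign: σ is a permutation automorphism of H'
  obtain ⟨s, t, hs, ht, hH', hinv⟩ := exists_resign_of_odd hH haut (by decide : Odd 167) hπ hκ
  set H' : Matrix ι ι ℤ := Matrix.of fun i j => s i * t j * H i j with hH'def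
  have hinv' : ∀ i j, H' (π i) (κ j) = H' i j := fun i j => by
    simp only [hH'def, Matrix.of_apply]; exact hinv i j
  have hinvm : ∀ m i j, H' ((π ^ m) i) ((κ ^ m) j) = H' i j := perm_aut_pow hinv'
  have hH'ne : ∀ i j, H' i j ≠ 0 := fun i j => pm_ne_zero (hH'.1 i j)
  -- labels
  set P : ZMod 2 × ZMod 2 → Equiv.Perm ι := fun g => π₁ ^ g.1.val * π₂ ^ g.2.val with hPdef
  set Q : ZMod 2 × ZMod 2 → Equiv.Perm ι := fun g => κ₁ ^ g.1.val * κ₂ ^ g.2.val with hQdef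
  set Eg : ZMod 2 × ZMod 2 → ι → ℤ := fun g j => cyc κ₁ e₁ ((κ₂ ^ g.2.val) j) g.1.val * cyc κ₂ e₂ j g.2.val with hEgdef
  set D' : ZMod 2 × ZMod 2 → ι → ℤ := fun g i =>
    s (P g i) * s i * (cyc π₁ d₁ ((π₂ ^ g.2.val) i) g.1.val * cyc π₂ d₂ i g.2.val) with hD'def
  set E' : ZMod 2 × ZMod 2 → ι → ℤ := fun g j => t (Q g j) * t j * Eg g j with hE'def
  have hT' : ∀ g, IsSignedAut H' (P g) (Q g) (D' g) (E' g) :=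
    fun g => signedAut_resign' hs ht (isSignedAut_mul (isSignedAut_pow h₁ g.1.val) (isSignedAut_pow h₂ g.2.val))
  have hcR : ∀ g, Commute (P g) π := fun g => (hc₁.pow_left _).mul_left (hc₂.pow_left _)
  have hcC : ∀ g, Commute (Q g) κ := fun g => (hc₁'.pow_left _).mul_left (hc₂'.pow_left _)
  have hQadd : ∀ g h, Q (g + h) = Q g * Q h := fun g h => v4_label_add hi₁' hi₂' hcomm' g h
  have hconst : ∀ g, (∀ k x, D' g ((π ^ k) x) = D' g x) ∧ (∀ k y, E' g ((κ ^ k) y) = E' g y) :=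
    fun g => signs_const_of_commute hH'ne hinv' (by decide : Odd 167) hπ (hT' g) (hcR g) (hcC g) x₀
  -- the quaternion cocycle at the H' level
  have hE'pm : ∀ g j, E' g j = 1 ∨ E' g j = -1 := fun g j => (hT' g).2.1 j
  have hcoc : ∀ g k y, E' g (Q k y) * E' k y =
      (if g = 0 ∨ k = 0 then (1 : ℤ) else if g = (1, 0) then (if k.1 = 1 then -1 else 1)
        else if g = (0, 1) then (if k = (1, 1) then 1 else -1) else (if k = (1, 0) then 1 else -1)) * E' (g + k) y := by
    intro g k y
    have hq := quaternion_cocycle h₁.2.1 h₂.2.1 hcomm' hi₂' hN1 hN2 hAC g k y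
    have htt := pm_mul_self (ht (Q k y))
    have hQQ : Q g (Q k y) = Q (g + k) y := by rw [hQadd]; rfl
    simp only [hE'def, hEgdef, hQdef] at hq hQQ ⊢
    rw [hQQ]
    calc t ((κ₁ ^ (g + k).1.val * κ₂ ^ (g + k).2.val) y) * t ((κ₁ ^ k.1.val * κ₂ ^ k.2.val) y) *
          (cyc κ₁ e₁ ((κ₂ ^ g.2.val) ((κ₁ ^ k.1.val * κ₂ ^ k.2.val) y)) g.1.val *
            cyc κ₂ e₂ ((κ₁ ^ k.1.val * κ₂ ^ k.2.val) y) g.2.val) *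
          (t ((κ₁ ^ k.1.val * κ₂ ^ k.2.val) y) * t y * (cyc κ₁ e₁ ((κ₂ ^ k.2.val) y) k.1.val * cyc κ₂ e₂ y k.2.val))
        = t ((κ₁ ^ (g + k).1.val * κ₂ ^ (g + k).2.val) y) * t y *
            (t ((κ₁ ^ k.1.val * κ₂ ^ k.2.val) y) * t ((κ₁ ^ k.1.val * κ₂ ^ k.2.val) y)) *
            ((cyc κ₁ e₁ ((κ₂ ^ g.2.val) ((κ₁ ^ k.1.val * κ₂ ^ k.2.val) y)) g.1.val *
                cyc κ₂ e₂ ((κ₁ ^ k.1.val * κ₂ ^ k.2.val) y) g.2.val) *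
              (cyc κ₁ e₁ ((κ₂ ^ k.2.val) y) k.1.val * cyc κ₂ e₂ y k.2.val)) := by ring
      _ = _ := by rw [htt, mul_one, hq]; ring
  -- θ(g,h) in closed form
  have hθ : ∀ g h, E' g (Q (g + h) y₀) =
      (if g = 0 then (1 : ℤ) else if g = (1, 0) then (if h.1 = 1 then 1 else -1)
        else if g = (0, 1) then (if h.1 = h.2 then -1 else 1) else (if h.2 = 1 then 1 else -1)) *
        E' h y₀ * E' (g + h) y₀ := by
    intro g h
    have hc := hcoc g (g + h) y₀
    rw [v4_facts.2.1 g h, ← thetaW_eq_cocycle g h] at hc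
    have hsq := pm_mul_self (hE'pm (g + h) y₀)
    calc E' g (Q (g + h) y₀) = E' g (Q (g + h) y₀) * (E' (g + h) y₀ * E' (g + h) y₀) := by rw [hsq, mul_one]
      _ = (E' g (Q (g + h) y₀) * E' (g + h) y₀) * E' (g + h) y₀ := by ring
      _ = _ := by rw [hc]
  -- the bijections (as in Order167WilliamsonType668), based at x₀ and y₀
  let fR : (ZMod 2 × ZMod 2) × ZMod 167 → ι := fun a => (π ^ a.2.val) (P a.1 x₀)
  let fC : (ZMod 2 × ZMod 2) × ZMod 167 → ι := fun b => (κ ^ b.2.val) (Q b.1 y₀)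
  have hcardV : Fintype.card ((ZMod 2 × ZMod 2) × ZMod 167) = 668 := by simp [ZMod.card]
  have hbR : Function.Bijective fR := by
    rw [Fintype.bijective_iff_injective_and_card]
    exact ⟨v4_orbitMap_injective hH hι haut hπ hκ hne h₁ h₂ hc₁ hc₁' hc₂ hc₂' hi₁ hi₁' hi₂ hi₂' hne₁ hne₂ hne₁₂ x₀,
      by rw [hcardV, hι]⟩
  have hbC : Function.Bijective fC := by
    rw [Fintype.bijective_iff_injective_and_card]
    refine ⟨?_, by rw [hcardV, hι]⟩
    have hT := isHadamard_transpose hH hcard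
    exact v4_orbitMap_injective hT hι (isSignedAut_transpose haut) hκ hπ hne.symm (isSignedAut_transpose h₁)
      (isSignedAut_transpose h₂) hc₁' hc₁ hc₂' hc₂ hi₁' hi₁ hi₂' hi₂ hne₁.symm hne₂.symm hne₁₂.symm y₀
  let ER : (ZMod 2 × ZMod 2) × ZMod 167 ≃ ι := Equiv.ofBijective fR hbR
  let EC : (ZMod 2 × ZMod 2) × ZMod 167 ≃ ι := Equiv.ofBijective fC hbC
  -- the reindexed matrix M and its entries
  have hentry : ∀ a b : (ZMod 2 × ZMod 2) × ZMod 167,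
      H' (ER a) (EC b) = D' a.1 x₀ * E' a.1 (Q (a.1 + b.1) y₀) * H' x₀ ((κ ^ (b.2 - a.2).val) (Q (a.1 + b.1) y₀)) := by
    rintro ⟨g, s'⟩ ⟨h, t'⟩
    show H' ((π ^ s'.val) (P g x₀)) ((κ ^ t'.val) (Q h y₀)) =
      D' g x₀ * E' g (Q (g + h) y₀) * H' x₀ ((κ ^ (t' - s').val) (Q (g + h) y₀))
    have hQh : Q h = Q g * Q (g + h) := by rw [← hQadd, v4_facts.2.1]
    have e1 : (κ ^ t'.val) (Q h y₀) = Q g ((κ ^ t'.val) (Q (g + h) y₀)) := by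
      rw [hQh, Equiv.Perm.mul_apply (Q g) (Q (g + h)), ← Equiv.Perm.mul_apply (κ ^ t'.val) (Q g),
        ← ((hcC g).pow_right t'.val).eq, Equiv.Perm.mul_apply]
    have e2 : (π ^ s'.val) (P g x₀) = P g ((π ^ s'.val) x₀) := by
      rw [← Equiv.Perm.mul_apply, ← ((hcR g).pow_right s'.val).eq, Equiv.Perm.mul_apply]
    rw [e1, e2, (hT' g).2.2, (hconst g).1, (hconst g).2]
    have e3 : (κ ^ t'.val) (Q (g + h) y₀) = (κ ^ s'.val) ((κ ^ (t' - s').val) (Q (g + h) y₀)) := by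
      rw [← Equiv.Perm.mul_apply (κ ^ s'.val) (κ ^ (t' - s').val), ← pow_add,
        ← pow_mod_of_pow_eq_one κ hκ (s'.val + (t' - s').val), ← ZMod.val_add, add_sub_cancel]
    rw [e3, hinvm]
  have hMhad : IsHadamardMatrix (H'.submatrix ER EC) := by
    refine ⟨fun a b => hH'.1 _ _, ?_⟩
    rw [Matrix.transpose_submatrix, Matrix.submatrix_mul_equiv, hH'.2]
    ext a b
    rw [Matrix.submatrix_apply, Matrix.smul_apply, Matrix.one_apply, Matrix.smul_apply, Matrix.one_apply, hι]
    simp only [EmbeddingLike.apply_eq_iff_eq]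
    simp [ZMod.card]
  -- the Williamson array of A' is the re-signed M; A' is symmetric thanks to ρ
  refine ⟨fun k r => E' k y₀ * H' x₀ ((κ ^ r.val) (Q k y₀)), fun k r => ?_, ?_⟩
  · -- symmetry of the blocks from the inverting automorphism based at its fixed points
    set dρ : ι → ℤ := fun i => s (π' i) * s i * d' i with hdρ
    set eρ : ι → ℤ := fun j => t (κ' j) * t j * e' j with heρ
    have hρ' : IsSignedAut H' π' κ' dρ eρ := signedAut_resign' hs ht haut'
    obtain ⟨-, heκ⟩ := signs_const_of_normalizing hH'ne hinv' (by decide : Odd 167) hπ hρ' hnπ hnκ x₀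
    have hQfix : κ' (Q k y₀) = Q k y₀ := by
      have hc : Commute κ' (Q k) := (hcm₁'.pow_right _).mul_right (hcm₂'.pow_right _)
      rw [← Equiv.Perm.mul_apply, hc.eq, Equiv.Perm.mul_apply, hy₀]
    have hμ' : (μ : ZMod 167) = -1 := by
      rw [← ZMod.natCast_mod μ 167, hμ]; exact zmod167_166
    have e1 : κ ^ (μ * r.val) = κ ^ (-r).val := by
      apply pow_eq_pow_of_natCast_eq_n hκ
      rw [ZMod.natCast_zmod_val]; push_cast; rw [ZMod.natCast_zmod_val, hμ']; ring
    have h0 := hρ'.2.2 x₀ (Q k y₀)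
    rw [hx₀, hQfix] at h0
    have hη : dρ x₀ * eρ (Q k y₀) = 1 := by
      have hne0 : H' x₀ (Q k y₀) ≠ 0 := hH'ne _ _
      have : (dρ x₀ * eρ (Q k y₀) - 1) * H' x₀ (Q k y₀) = 0 := by linarith
      rcases mul_eq_zero.mp this with h9 | h9
      · linarith
      · exact (hne0 h9).elim
    have h1 := hρ'.2.2 x₀ ((κ ^ r.val) (Q k y₀))
    rw [hx₀, norm_apply_pow hnκ r.val, hQfix, heκ, e1, hη, one_mul] at h1
    show E' k y₀ * H' x₀ ((κ ^ (-r).val) (Q k y₀)) = E' k y₀ * H' x₀ ((κ ^ r.val) (Q k y₀))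
    rw [h1]
  have hW : (Matrix.of fun (a b : (ZMod 2 × ZMod 2) × ZMod 167) =>
        (if a.1 = 0 then (1 : ℤ) else if a.1 = (1, 0) then (if b.1.1 = 1 then 1 else -1)
          else if a.1 = (0, 1) then (if b.1.1 = b.1.2 then -1 else 1) else (if b.1.2 = 1 then 1 else -1)) *
        (E' (a.1 + b.1) y₀ * H' x₀ ((κ ^ (b.2 - a.2).val) (Q (a.1 + b.1) y₀)))) =
      Matrix.of fun a b => D' a.1 x₀ * E' b.1 y₀ * (H'.submatrix ER EC) a b := by
    ext a b
    rw [Matrix.of_apply, Matrix.of_apply, Matrix.submatrix_apply, hentry, hθ]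
    have hdd := pm_mul_self ((hT' a.1).1 x₀)
    have hee := pm_mul_self (hE'pm b.1 y₀)
    set θv := (if a.1 = 0 then (1 : ℤ) else if a.1 = (1, 0) then (if b.1.1 = 1 then 1 else -1)
          else if a.1 = (0, 1) then (if b.1.1 = b.1.2 then -1 else 1) else (if b.1.2 = 1 then 1 else -1)) with hθv
    calc θv * (E' (a.1 + b.1) y₀ * H' x₀ ((κ ^ (b.2 - a.2).val) (Q (a.1 + b.1) y₀)))
        = θv * (E' (a.1 + b.1) y₀ * H' x₀ ((κ ^ (b.2 - a.2).val) (Q (a.1 + b.1) y₀))) *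
            ((D' a.1 x₀ * D' a.1 x₀) * (E' b.1 y₀ * E' b.1 y₀)) := by rw [hdd, hee, mul_one, mul_one]
      _ = D' a.1 x₀ * E' b.1 y₀ * (D' a.1 x₀ * (θv * E' b.1 y₀ * E' (a.1 + b.1) y₀) *
            H' x₀ ((κ ^ (b.2 - a.2).val) (Q (a.1 + b.1) y₀))) := by ring
  rw [hW]
  exact isHadamard_resign hMhad (fun a => (hT' a.1).1 x₀) (fun b => hE'pm b.1 y₀)

/-- **Index 4 + any automorphism inverting `σ` ⇒ a classical Williamson matrix** (symmetric circulant blocks of order 167). -/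
theorem exists_symmWilliamsonArray_of_index_four_inverting :
    ∃ A' : ZMod 2 × ZMod 2 → ZMod 167 → ℤ, (∀ k r, A' k (-r) = A' k r) ∧
      IsHadamardMatrix (Matrix.of fun (a b : (ZMod 2 × ZMod 2) × ZMod 167) =>
        (if a.1 = 0 then (1 : ℤ) else if a.1 = (1, 0) then (if b.1.1 = 1 then 1 else -1)
          else if a.1 = (0, 1) then (if b.1.1 = b.1.2 then -1 else 1) else (if b.1.2 = 1 then 1 else -1)) *
        A' (a.1 + b.1) (b.2 - a.2)) := by
  obtain ⟨⟨hcomm, hcomm'⟩, -, -⟩ :=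
    centralizer167_involutions_commute hH hι haut hπ hκ hne h₁ h₂ hc₁ hc₁' hc₂ hc₂' hi₁ hi₁' hi₂ hi₂'
  obtain ⟨g, ⟨D, E, hρ⟩, hnρ, hnρ', hs2, hs2', hrows, -, hcr, hcc⟩ := exists_blockPreserving_inverting hH hι haut hπ hκ
    hne h₁ h₂ hc₁ hc₁' hc₂ hc₂' hi₁ hi₁' hi₂ hi₂' hne₁ hne₂ hne₁₂ haut' hnπ hnκ hμ
  obtain ⟨x₁, hx₁⟩ : (univ.filter fun x => (π₁ ^ g.1.val * π₂ ^ g.2.val * π') x = x).Nonempty := by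
    rw [← Finset.card_pos, hcr]; norm_num
  obtain ⟨y₁, hy₁⟩ : (univ.filter fun y => (κ₁ ^ g.1.val * κ₂ ^ g.2.val * κ') y = y).Nonempty := by
    rw [← Finset.card_pos, hcc]; norm_num
  have hx₁' := (Finset.mem_filter.mp hx₁).2
  have hy₁' := (Finset.mem_filter.mp hy₁).2
  obtain ⟨-, hk₁⟩ := inverting_involution_commute_label hH hι haut hπ hκ hne hρ hnρ hnρ' hμ h₁ hc₁ hc₁' hi₁ hi₁' hs2
    hs2' hrows hx₁'
  obtain ⟨-, hk₂⟩ := inverting_involution_commute_label hH hι haut hπ hκ hne hρ hnρ hnρ' hμ h₂ hc₂ hc₂' hi₂ hi₂' hs2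
    hs2' hrows hx₁'
  exact exists_symmWilliamsonArray_of_inverting_fixed hH hι haut hπ hκ hne h₁ h₂ hc₁ hc₁' hc₂ hc₂' hi₁ hi₁' hi₂ hi₂' hne₁
    hne₂ hne₁₂ hρ hnρ hnρ' hμ hk₁ hk₂ hx₁' hy₁'

end main

/-! ### the converse: a symmetric Williamson array has the block reversal -/

/-- **For SYMMETRIC blocks the block reversal `(g, s) ↦ (g, −s)` is a permutation automorphism of the Williamson array,
inverting the block shift (`ρ₀ σ₀ = σ₀^166 ρ₀`) and fixing the row and the column `((0,0),0)`.** -/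
theorem symmWilliamsonArray_inverting_aut (A : ZMod 2 × ZMod 2 → ZMod 167 → ℤ) (hsym : ∀ k r, A k (-r) = A k r) :
    IsSignedAut (Matrix.of fun (a b : (ZMod 2 × ZMod 2) × ZMod 167) =>
        (if a.1 = 0 then (1 : ℤ) else if a.1 = (1, 0) then (if b.1.1 = 1 then 1 else -1)
          else if a.1 = (0, 1) then (if b.1.1 = b.1.2 then -1 else 1) else (if b.1.2 = 1 then 1 else -1)) *
        A (a.1 + b.1) (b.2 - a.2))
      (Equiv.prodCongr (Equiv.refl (ZMod 2 × ZMod 2)) (Equiv.neg (ZMod 167)))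
      (Equiv.prodCongr (Equiv.refl (ZMod 2 × ZMod 2)) (Equiv.neg (ZMod 167))) (fun _ => 1) (fun _ => 1) ∧
    (Equiv.prodCongr (Equiv.refl (ZMod 2 × ZMod 2)) (Equiv.neg (ZMod 167)) : Equiv.Perm ((ZMod 2 × ZMod 2) × ZMod 167)) *
        Equiv.prodCongr (Equiv.refl (ZMod 2 × ZMod 2)) (Equiv.addRight (1 : ZMod 167)) =
      (Equiv.prodCongr (Equiv.refl (ZMod 2 × ZMod 2)) (Equiv.addRight (1 : ZMod 167))) ^ 166 *
        Equiv.prodCongr (Equiv.refl (ZMod 2 × ZMod 2)) (Equiv.neg (ZMod 167)) ∧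
    (Equiv.prodCongr (Equiv.refl (ZMod 2 × ZMod 2)) (Equiv.neg (ZMod 167))) (((0, 0) : ZMod 2 × ZMod 2), (0 : ZMod 167)) =
      (((0, 0) : ZMod 2 × ZMod 2), (0 : ZMod 167)) := by
  set τ₀ : Equiv.Perm ((ZMod 2 × ZMod 2) × ZMod 167) := Equiv.prodCongr (Equiv.refl (ZMod 2 × ZMod 2)) (Equiv.neg (ZMod 167))
    with hτ₀
  have hτapp : ∀ a : (ZMod 2 × ZMod 2) × ZMod 167, τ₀ a = (a.1, -a.2) := fun ⟨g, s⟩ => rfl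
  have hσ1 : ∀ a : (ZMod 2 × ZMod 2) × ZMod 167,
      (Equiv.prodCongr (Equiv.refl (ZMod 2 × ZMod 2)) (Equiv.addRight (1 : ZMod 167))) a = (a.1, a.2 + 1) :=
    fun ⟨g, s⟩ => rfl
  refine ⟨⟨fun _ => Or.inl rfl, fun _ => Or.inl rfl, fun i j => ?_⟩, ?_, ?_⟩
  · rw [Matrix.of_apply, Matrix.of_apply, hτapp, hτapp]
    simp only [one_mul]
    rw [show -j.2 - -i.2 = -(j.2 - i.2) by ring, hsym]
  · apply Equiv.ext
    intro a
    rw [Equiv.Perm.mul_apply, Equiv.Perm.mul_apply, hσ1, hτapp, hτapp, blockShift_pow_apply]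
    refine Prod.ext rfl ?_
    show -(a.2 + 1) = -a.2 + ((166 : ℕ) : ZMod 167)
    rw [zmod167_166]; ring
  · rw [hτapp]; rfl

/-- **(∃ H(668) with |N(⟨σ₁₆₇⟩) : ±⟨σ₁₆₇⟩| = 8) ⇔ (∃ a Williamson matrix of order 668 with symmetric circulant blocks).**
Left: a Hadamard matrix of order `668` with a signed automorphism `σ` of pair exponent `167`, two signed automorphisms
commuting with it whose pairs are distinct non-trivial involutions (index-4 centraliser), and a signed automorphism inverting
it (`μ ≡ 166`).  Right: `A, B, C, D : ℤ/167 → ℤ` symmetric with `W(A,B,C,D)` Hadamard. -/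
theorem hadamard668_normalizer_index_eight_iff_williamson :
    (∃ (ι : Type) (_ : Fintype ι) (_ : DecidableEq ι) (H : Matrix ι ι ℤ) (π κ π₁ κ₁ π₂ κ₂ π' κ' : Equiv.Perm ι)
        (d e d₁ e₁ d₂ e₂ d' e' : ι → ℤ) (μ : ℕ), Fintype.card ι = 668 ∧ IsHadamardMatrix H ∧ IsSignedAut H π κ d e ∧
        π ^ 167 = 1 ∧ κ ^ 167 = 1 ∧ (π ≠ 1 ∨ κ ≠ 1) ∧ IsSignedAut H π₁ κ₁ d₁ e₁ ∧ IsSignedAut H π₂ κ₂ d₂ e₂ ∧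
        Commute π₁ π ∧ Commute κ₁ κ ∧ Commute π₂ π ∧ Commute κ₂ κ ∧ π₁ ^ 2 = 1 ∧ κ₁ ^ 2 = 1 ∧ π₂ ^ 2 = 1 ∧ κ₂ ^ 2 = 1 ∧
        (π₁ ≠ 1 ∨ κ₁ ≠ 1) ∧ (π₂ ≠ 1 ∨ κ₂ ≠ 1) ∧ (π₁ ≠ π₂ ∨ κ₁ ≠ κ₂) ∧ IsSignedAut H π' κ' d' e' ∧
        π' * π = π ^ μ * π' ∧ κ' * κ = κ ^ μ * κ' ∧ μ % 167 = 166) ↔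
    ∃ A : ZMod 2 × ZMod 2 → ZMod 167 → ℤ, (∀ k r, A k (-r) = A k r) ∧
      IsHadamardMatrix (Matrix.of fun (a b : (ZMod 2 × ZMod 2) × ZMod 167) =>
        (if a.1 = 0 then (1 : ℤ) else if a.1 = (1, 0) then (if b.1.1 = 1 then 1 else -1)
          else if a.1 = (0, 1) then (if b.1.1 = b.1.2 then -1 else 1) else (if b.1.2 = 1 then 1 else -1)) *
        A (a.1 + b.1) (b.2 - a.2)) := by
  constructor
  · rintro ⟨ι, _, _, H, π, κ, π₁, κ₁, π₂, κ₂, π', κ', d, e, d₁, e₁, d₂, e₂, d', e', μ, hι, hH, haut, hπ, hκ, hne, h₁, h₂, hc₁,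
      hc₁', hc₂, hc₂', hi₁, hi₁', hi₂, hi₂', hne₁, hne₂, hne₁₂, haut', hnπ, hnκ, hμ⟩
    exact exists_symmWilliamsonArray_of_index_four_inverting hH hι haut hπ hκ hne h₁ h₂ hc₁ hc₁' hc₂ hc₂' hi₁ hi₁' hi₂
      hi₂' hne₁ hne₂ hne₁₂ haut' hnπ hnκ hμ
  · rintro ⟨A, hsym, hW⟩
    obtain ⟨hσ, h167, hσne⟩ := williamsonArray_shift_aut A
    obtain ⟨ha, hca, ha2, hane⟩ := williamsonArray_translate_aut_a A
    obtain ⟨hb, hcb, hb2, hbne, hab⟩ := williamsonArray_translate_aut_b A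
    obtain ⟨hρ, hn, -⟩ := symmWilliamsonArray_inverting_aut A hsym
    exact ⟨(ZMod 2 × ZMod 2) × ZMod 167, inferInstance, inferInstance, _, _, _, _, _, _, _, _, _, _, _, _, _, _, _, _, _, 166,
      by simp [ZMod.card], hW, hσ, h167, h167, Or.inl hσne, ha, hb, hca, hca, hcb, hcb, ha2, ha2, hb2, hb2, Or.inl hane,
      Or.inl hbne, Or.inl hab, hρ, hn, hn, rfl⟩

/-- the same iff with 'a normalising automorphism that does NOT centralise `σ`' on the left (any multiplier `μ`): by the
dichotomy of gen 21 such an automorphism inverts `σ` -/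
theorem hadamard668_normalizer_index_eight_iff_williamson' :
    (∃ (ι : Type) (_ : Fintype ι) (_ : DecidableEq ι) (H : Matrix ι ι ℤ) (π κ π₁ κ₁ π₂ κ₂ π' κ' : Equiv.Perm ι)
        (d e d₁ e₁ d₂ e₂ d' e' : ι → ℤ) (μ : ℕ), Fintype.card ι = 668 ∧ IsHadamardMatrix H ∧ IsSignedAut H π κ d e ∧
        π ^ 167 = 1 ∧ κ ^ 167 = 1 ∧ (π ≠ 1 ∨ κ ≠ 1) ∧ IsSignedAut H π₁ κ₁ d₁ e₁ ∧ IsSignedAut H π₂ κ₂ d₂ e₂ ∧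
        Commute π₁ π ∧ Commute κ₁ κ ∧ Commute π₂ π ∧ Commute κ₂ κ ∧ π₁ ^ 2 = 1 ∧ κ₁ ^ 2 = 1 ∧ π₂ ^ 2 = 1 ∧ κ₂ ^ 2 = 1 ∧
        (π₁ ≠ 1 ∨ κ₁ ≠ 1) ∧ (π₂ ≠ 1 ∨ κ₂ ≠ 1) ∧ (π₁ ≠ π₂ ∨ κ₁ ≠ κ₂) ∧ IsSignedAut H π' κ' d' e' ∧
        π' * π = π ^ μ * π' ∧ κ' * κ = κ ^ μ * κ' ∧ ¬ (Commute π' π ∧ Commute κ' κ)) ↔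
    ∃ A : ZMod 2 × ZMod 2 → ZMod 167 → ℤ, (∀ k r, A k (-r) = A k r) ∧
      IsHadamardMatrix (Matrix.of fun (a b : (ZMod 2 × ZMod 2) × ZMod 167) =>
        (if a.1 = 0 then (1 : ℤ) else if a.1 = (1, 0) then (if b.1.1 = 1 then 1 else -1)
          else if a.1 = (0, 1) then (if b.1.1 = b.1.2 then -1 else 1) else (if b.1.2 = 1 then 1 else -1)) *
        A (a.1 + b.1) (b.2 - a.2)) := by
  rw [← hadamard668_normalizer_index_eight_iff_williamson]
  constructor
  · rintro ⟨ι, _, _, H, π, κ, π₁, κ₁, π₂, κ₂, π', κ', d, e, d₁, e₁, d₂, e₂, d', e', μ, hι, hH, haut, hπ, hκ, hne, h₁, h₂, hc₁,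
      hc₁', hc₂, hc₂', hi₁, hi₁', hi₂, hi₂', hne₁, hne₂, hne₁₂, haut', hnπ, hnκ, hnc⟩
    have hμ' : (μ : ZMod 167) = -1 :=
      (hadamard668_order167_normalizer_dichotomy hH hι haut hπ hκ hne haut' hnπ hnκ).resolve_left hnc
    have hμ : μ % 167 = 166 := by
      rw [← zmod167_166, ZMod.natCast_eq_natCast_iff'] at hμ'
      simpa using hμ'
    exact ⟨ι, _, _, H, π, κ, π₁, κ₁, π₂, κ₂, π', κ', d, e, d₁, e₁, d₂, e₂, d', e', μ, hι, hH, haut, hπ, hκ, hne, h₁, h₂, hc₁,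
      hc₁', hc₂, hc₂', hi₁, hi₁', hi₂, hi₂', hne₁, hne₂, hne₁₂, haut', hnπ, hnκ, hμ⟩
  · rintro ⟨ι, _, _, H, π, κ, π₁, κ₁, π₂, κ₂, π', κ', d, e, d₁, e₁, d₂, e₂, d', e', μ, hι, hH, haut, hπ, hκ, hne, h₁, h₂, hc₁,
      hc₁', hc₂, hc₂', hi₁, hi₁', hi₂, hi₂', hne₁, hne₂, hne₁₂, haut', hnπ, hnκ, hμ⟩
    refine ⟨ι, _, _, H, π, κ, π₁, κ₁, π₂, κ₂, π', κ', d, e, d₁, e₁, d₂, e₂, d', e', μ, hι, hH, haut, hπ, hκ, hne, h₁, h₂, hc₁,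
      hc₁', hc₂, hc₂', hi₁, hi₁', hi₂, hi₂', hne₁, hne₂, hne₁₂, haut', hnπ, hnκ, ?_⟩
    -- an inverting automorphism does not centralise: π' π = π π' with π' π = π^μ π' would give π^μ = π, π² = 1
    rintro ⟨hc, -⟩
    have h167 := hadamard668_fixedRows_167 hH hι π κ d e haut hπ hκ hne
    obtain ⟨x⟩ : Nonempty ι := Fintype.card_pos_iff.mp (by rw [hι]; norm_num)
    have h3 : π ^ μ = π := by
      have h4 : π ^ μ * π' = π * π' := by rw [← hnπ, hc.eq]
      exact mul_right_cancel h4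
    have h2 : π ^ (2 * 1) = 1 := by
      have h5 : π ^ (μ * 1 + 1) = 1 := pow_mu_succ_mul_eq_one hπ hμ 1
      rw [mul_one, pow_succ, h3] at h5
      rw [mul_one, pow_two]; exact h5
    have h6 := pow_eq_one_of_sq_pow_167 hπ h2
    rw [pow_one] at h6
    exact moved_of_card_fixed_eq_zero π h167.1 x (by rw [h6, Equiv.Perm.one_apply])

/-! ### control: the right-hand side at block order 3 (Williamson's H(12)) -/

set_option maxRecDepth 100000 in
/-- **(+) control, order 12**: Williamson's `H(12)` (`A = J₃`, `B = C = D = 2I − J₃`) has SYMMETRIC circulant blocks and is a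
Hadamard matrix in the `θ_W` convention — the right-hand side of the iff is inhabited at `w = 3` (at `w = 167` it is the open
classical Williamson question). -/
theorem symmWilliamsonArray_control_order12 :
    ∃ A : ZMod 2 × ZMod 2 → ZMod 3 → ℤ, (∀ k r, A k (-r) = A k r) ∧
      IsHadamardMatrix (Matrix.of fun (a b : (ZMod 2 × ZMod 2) × ZMod 3) =>
        (if a.1 = 0 then (1 : ℤ) else if a.1 = (1, 0) then (if b.1.1 = 1 then 1 else -1)
          else if a.1 = (0, 1) then (if b.1.1 = b.1.2 then -1 else 1) else (if b.1.2 = 1 then 1 else -1)) *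
        A (a.1 + b.1) (b.2 - a.2)) :=
  ⟨fun k r => if k = 0 then (1 : ℤ) else if r = 0 then 1 else -1, by decide, williamsonArray_control_order12⟩

end Summit.Ventures.DiscreteObjects.Hadamard
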